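import Mathlib.Analysis.Normed.Affine.AddTorsorBases
import Mathlib.Analysis.Convex.Combination
import Mathlib.LinearAlgebra.AffineSpace.FiniteDimensional
import HarnessLib

/-!
# A point of a full simplex off all its facets is interior

Topic `Literature/Topology/FourManifolds` (convex geometry); used by the case analysis of the
vertex stage of the smoothing sweep (Munkres, Ann. of Math. 72 (1960), §5): a point of a closed
top simplex which lies on none of its facets is an interior point, so near it the PD transition
is the smooth sector map.

* `mem_interior_convexHull_of_forall_notMem_erase` — for an affinely independent `t` with
  `t.card = dim E + 1`: `x ∈ conv t` and `x ∉ conv (t.erase w)` for all `w ∈ t` imply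
  `x ∈ interior (conv t)` (barycentric coordinates w.r.t. the affine basis `t`; Mathlib's
  `AffineBasis.interior_convexHull`).

Everything is proved; no definitions; no named facts.

## References

* J. R. Munkres, *Obstructions to the smoothing of piecewise-differentiable homeomorphisms*, Ann.
  of Math. (2) 72 (1960), 521–554, §5. [Munkres1960]
-/

noncomputable section

open Set Function

namespace Literature.Topology.FourManifolds

variable {E : Type*} [NormedAddCommGroup E] [NormedSpace ℝ E] [FiniteDimensional ℝ E]

/-- **A point of a full simplex off all its facets is interior.** [folklore] -/
theorem mem_interior_convexHull_of_forall_notMem_erase [DecidableEq E] {t : Finset E}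
    (ht : AffineIndependent ℝ ((↑) : t → E)) (hcard : t.card = Module.finrank ℝ E + 1) {x : E}
    (hx : x ∈ convexHull ℝ (t : Set E)) (hno : ∀ w ∈ t, x ∉ convexHull ℝ ((t.erase w : Finset E) : Set E)) :
    x ∈ interior (convexHull ℝ (t : Set E)) := by
  classical
  -- `t` is an affine basis
  have htot : affineSpan ℝ (range ((↑) : t → E)) = ⊤ := by
    refine ht.affineSpan_eq_top_iff_card_eq_finrank_add_one.2 ?_
    rw [Fintype.card_coe, hcard]
  let b : AffineBasis t ℝ E := ⟨(↑), ht, htot⟩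
  have hb : ∀ i : t, b i = (i : E) := fun i => rfl
  have hrange : range b = (t : Set E) := by
    show range ((↑) : t → E) = _; exact Subtype.range_coe
  rw [← hrange, b.interior_convexHull]
  -- coordinates are nonnegative on the closed simplex
  have hnonneg : ∀ i, 0 ≤ b.coord i x := by
    have : x ∈ convexHull ℝ (range b) := by rwa [hrange]
    rw [b.convexHull_eq_nonneg_coord] at this
    exact this
  intro i
  rcases (hnonneg i).lt_or_eq with h | h
  · exact h
  · -- `coord_i x = 0`: `x` lies on the facet opposite `i`
    exfalso
    refine hno i i.2 ?_
    have hsum : ∑ j, b.coord j x = 1 := b.sum_coord_apply_eq_one _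
    have hrepr : ∑ j, b.coord j x • b j = x := b.linear_combination_coord_eq_self _
    have hsum' : ∑ j ∈ Finset.univ.erase i, b.coord j x = 1 := by
      rw [← Finset.add_sum_erase _ _ (Finset.mem_univ i), ← h, zero_add] at hsum; exact hsum
    have hrepr' : ∑ j ∈ Finset.univ.erase i, b.coord j x • b j = x := by
      rw [← Finset.add_sum_erase _ _ (Finset.mem_univ i), ← h, zero_smul, zero_add] at hrepr
      exact hrepr
    rw [← hrepr']
    refine (convex_convexHull ℝ _).sum_mem (fun j _ => hnonneg j) hsum' fun j hj => ?_
    apply subset_convexHull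
    rw [hb]
    exact Finset.mem_coe.2 (Finset.mem_erase.2 ⟨fun heq => Finset.ne_of_mem_erase hj (Subtype.ext heq), j.2⟩)

end Literature.Topology.FourManifolds
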